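import Summits.HodgeConjecture.CorCM.CyclicSheetAnnihilator
import Summits.HodgeConjecture.CorCM.SemilinearKernelNormCyclic
import Summits.HodgeConjecture.CorCM.GaloisCyclicSemidirectTwoPowerGroup
import Summits.HodgeConjecture.CorCM.GaloisOddMetacyclicCertificates
import Mathlib.Data.Nat.Factorization.Basic
import HarnessLib

/-!
# The `2^j`-sheet model of `C_p ⋊_r C_{2^{a+j+1}}` (`r^{2^j} ≡ 1 (mod p)`): odd character sums and DEGREE-`2^j` NORMS over
# `ℚ(ζ_{2^{a+1}p})`

COR-CM (cell `pub-hodgecm2`), binder seat b04 (gen 27), count-neutral — the `2^j`-SHEET PROGRAMME (A7-JUNCTION gen-26 addendum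
§C, road map (v)): the order-`2^j` form of `CorCM/GaloisCyclicSemidirectTwoPowerTwoSheet` (`j = 1`) and
`CorCM/GaloisCyclicSemidirectTwoPowerQuarticFourSheet` (`j = 2`).  The Galois group
`G₀ = C_p ⋊_r C_{2^{a+j+1}} = ⟨u, y | u^p = y^{2^{a+j+1}} = 1, y u y⁻¹ = u^r⟩` with `r^{2^j} ≡ 1 (mod p)` (an action of order
DIVIDING `2^j`), of order `2^{a+j+1} p`, unique involution `c₀ = y^{2^{a+j}}`.  KERNEL ONLY: theorems; no definition, no named
fact, no `sorry`.  `HC_CM` is neither used nor claimed.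

THE MECHANISM.  `A = ⟨y^{2^j}⟩ × ⟨u⟩ ≅ ℤ/2^{a+1} × ℤ/p` is abelian normal of index `2^j`, `G₀ = ⊔_{l<2^j} A·y^l`, conjugation
by `y` is `θ(t, v) = (t, v^r)`, `y^{2^j} = q = (1, 0)`, `c₀ = (2^a, 0)`.  For an odd character `χ` (`ω₀ = χ(q)`, `ω₀^{2^a} = −1`)
and a ring endomorphism `σ` of a subfield `M ⊇ μ_{2^{a+1}p}` of `ℂ` fixing `μ_{2^{a+1}}` and undoing the `r`-th power on `μ_p`,
with `σ^{2^j} = 1`, ELEMENT BY ELEMENT `σ(χ(θ t)) = χ(t)`; so the `2^j × 2^j` systems of the `2^j`-sheet annihilator lemma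
(`CorCM/CyclicSheetAnnihilator`, `δ < 2^j`) have the matrices `M^{(δ)}_{ik} = ω₀^{[i+J≥2^j]} σ^k(Ŝ_J(χ))`, `J ≡ k + δ − i`,
which satisfy `M P = P' σ(M)` with monomial `P`, `σ(P) = P`, `P^{2^j} = ω₀⁻¹` (`CorCM/CyclicSheetMatrix`).  By the SEMILINEAR
KERNEL TRICK (`CorCM/SemilinearKernelNormCyclic`) `det M^{(δ)} = 0 ≠ M^{(δ)}` makes `ω₀^{−d}` (`0 < d < 2^j`, `d = 2^s d'`, `d'`
odd, `s < j`) a degree-`2^j` norm `∏_{i<2^j} σ^i(z)`, hence `(ω₀^{−1})^{2^{j−1} d'}` one (`w = z^{2^{j−1−s}}`) — excluded by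
HYPOTHESIS `hN`; and `M^{(δ)} = 0` makes all `2^j` sheet sums vanish, so (`CorCM/CyclicHalfOddCharacterSums`, order `2^{a+1}·p`)
all sheets are `C_p`-periodic: `u^{2^{a+1}}` is a left stabiliser.  `hN` is discharged when `2^{a+1} ∥ p^f − 1` for some `f` and
`j ≤ a + 1` in `CorCM/CyclotomicTwoPowerPCyclicNormObstruction`.

* §1 `pow_r_pow_eq`, `phi_two_pow_pow` — the action of `y^{2^j}` on `C_p` is trivial; `prod_iterate_pow`.
* §2 **`eq_zero_of_annihilated_metacyclic`** — the model theorem.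

## References

* [Kubota1965] T. Kubota, Nagoya Math. J. 25 (1965) 113–120, §4 Lemma 2.
* [Dodson1984] B. Dodson, Trans. AMS 283 (1984) 1–32, §5.3.
* [Pierce1982] R. S. Pierce, *Associative Algebras*, GTM 88, Springer 1982, §15.1 (cyclic algebras, the norm criterion).
-/

noncomputable section

open scoped BigOperators

namespace Summit.HodgeConjecture.CorCM.GaloisMetacyclicTwoPower

open Literature.NumberTheory.ComplexMultiplication (IsCMTypeWith)
open Summit.HodgeConjecture.CorCM.CyclicTwoPower (mul_pow_mem_iff_of_sum_eq_zero)
open Summit.HodgeConjecture.CorCM.GaloisCyclicSemidirectTwoPower (orderOf_gamma mem_powers_gamma pow_omega)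
open Summit.HodgeConjecture.CorCM.GaloisOddMetacyclic (phi_pow_apply pow_mod_prime)
open Summit.HodgeConjecture.CorCM.CyclicSheet (sheet_mul_eq_mul_map sheetP_pow_map_eq sheetP_pow_eq
  sheetSum_eq_zero_of_sheet_eq_zero apply_eq_zero_of_sheet_det_ne_zero)
open AddChar

/-! ## §1 The action of `y^{2^j}` -/

section Action

variable {p a j : ℕ}

/-- `r^{2^j} ≡ 1 (mod p)` ⟹ `v^{r^{2^j k}} = v` on `ℤ/p`. [folklore] -/
theorem pow_r_pow_eq (hp : p.Prime) (r : ℕ) (hr : r ^ 2 ^ j % p = 1) (k : ℕ) (v : Multiplicative (ZMod p)) :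
    v ^ r ^ (2 ^ j * k) = v := by
  rw [pow_mod_prime hp v, pow_mul, Nat.pow_mod, hr, one_pow, Nat.mod_eq_of_lt hp.one_lt, pow_one]

/-- The action: `φ(2^j)^k = 1` (`y^{2^j}` centralises `C_p`). [folklore] -/
theorem phi_two_pow_pow (hp : p.Prime) (φ : Multiplicative (ZMod (2 ^ (a + j + 1))) →* MulAut (Multiplicative (ZMod p)))
    (r : ℕ) (hφ : ∀ v : Multiplicative (ZMod p), φ (Multiplicative.ofAdd 1) v = v ^ r) (hr : r ^ 2 ^ j % p = 1) (k : ℕ)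
    (v : Multiplicative (ZMod p)) :
    φ (Multiplicative.ofAdd (((2 ^ j : ℕ) : ZMod (2 ^ (a + j + 1)))) ^ k) v = v := by
  have h1 : Multiplicative.ofAdd (((2 ^ j : ℕ) : ZMod (2 ^ (a + j + 1)))) =
      Multiplicative.ofAdd (1 : ZMod (2 ^ (a + j + 1))) ^ 2 ^ j := by
    rw [← ofAdd_nsmul, nsmul_eq_mul, mul_one]
  rw [h1, ← pow_mul, phi_pow_apply r φ hφ, pow_r_pow_eq hp r hr]

/-- `∏_{i<n} σ^i(z^m) = (∏_{i<n} σ^i(z))^m`. [folklore] -/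
theorem prod_iterate_pow {L : Type*} [CommRing L] (σ : L →+* L) (n m : ℕ) (z : L) :
    ∏ i ∈ Finset.range n, σ^[i] (z ^ m) = (∏ i ∈ Finset.range n, σ^[i] z) ^ m := by
  rw [← Finset.prod_pow]
  refine Finset.prod_congr rfl fun i _ => ?_
  rw [← RingHom.coe_pow, map_pow]

end Action

/-! ## §2 The `2^j`-sheet model theorem -/

section Model

variable {p a : ℕ} [Fact p.Prime]

set_option maxHeartbeats 1600000 in
/-- **THE MODEL THEOREM (action of order dividing `2^j`).**  `p` an odd prime; `G₀ = C_p ⋊_r C_{2^{a+j+1}}` (`φ(1) v = v^r`,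
`r^{2^j} ≡ 1 (mod p)`); `M ⊆ ℂ` a subfield containing the `2^{a+1}p`-th roots of unity with a ring endomorphism `σ`, `σ^{2^j} = 1`,
fixing `μ_{2^{a+1}}` and with `σ(z^r) = z` on `μ_p`, such that no `ω^{2^{j−1}(2t+1)}` (`ω^{2^a} = −1`) is a degree-`2^j` norm
`∏_{i<2^j} σ^i(w)` (`hN`).  If `S ⊆ G₀` is a CM set for `c₀ = inr 2^{a+j} = y^{2^{a+j}}` and `u^{2^{a+1}} = inl 2^{a+1}` is not a left
stabiliser of `S`, then every `c₀`-antisymmetric `b : G₀ → ℚ` annihilated by all right translates of `S` is zero.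
[cite: Kubota1965, §4 Lemma 2] [cite: Dodson1984, §5.3] [cite: Pierce1982, §15.1] -/
theorem eq_zero_of_annihilated_metacyclic (hp2 : p ≠ 2) {j : ℕ} (hj1 : 1 ≤ j)
    (φ : Multiplicative (ZMod (2 ^ (a + j + 1))) →* MulAut (Multiplicative (ZMod p))) (r : ℕ)
    (hφ : ∀ v : Multiplicative (ZMod p), φ (Multiplicative.ofAdd 1) v = v ^ r) (hr : r ^ 2 ^ j % p = 1)
    (M : Subfield ℂ) (σ : M →+* M) (hM : ∀ z : ℂ, z ^ (2 ^ (a + 1) * p) = 1 → z ∈ M)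
    (hσ2 : ∀ z : M, (z : ℂ) ^ 2 ^ (a + 1) = 1 → σ z = z) (hσp : ∀ z : M, (z : ℂ) ^ p = 1 → σ (z ^ r) = z)
    (hσn : ∀ z : M, σ^[2 ^ j] z = z)
    (hN : ∀ (w : M) (ω : ℂ), ω ^ 2 ^ a = -1 → ∀ t : ℕ,
      ((∏ i ∈ Finset.range (2 ^ j), σ^[i] w : M) : ℂ) ≠ ω ^ (2 ^ (j - 1) * (2 * t + 1)))
    (S : Finset (Multiplicative (ZMod p) ⋊[φ] Multiplicative (ZMod (2 ^ (a + j + 1)))))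
    (hScm : ∀ g, SemidirectProduct.inr (Multiplicative.ofAdd ((2 ^ (a + j) : ℕ) : ZMod (2 ^ (a + j + 1)))) * g ∈ S ↔ g ∉ S)
    (hstab : ¬ ∀ w, w ∈ S ↔ SemidirectProduct.inl (Multiplicative.ofAdd ((2 ^ (a + 1) : ℕ) : ZMod p)) * w ∈ S)
    (b : Multiplicative (ZMod p) ⋊[φ] Multiplicative (ZMod (2 ^ (a + j + 1))) → ℚ)
    (hb : ∀ g, b (SemidirectProduct.inr (Multiplicative.ofAdd ((2 ^ (a + j) : ℕ) : ZMod (2 ^ (a + j + 1)))) * g) = -b g)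
    (hann : ∀ g, ∑ s ∈ S, b (s * g) = 0) : b = 0 := by
  classical
  have hp : p.Prime := Fact.out
  haveI : NeZero p := ⟨hp.ne_zero⟩
  haveI : NeZero (2 ^ (a + j + 1)) := ⟨by positivity⟩
  haveI : NeZero (2 ^ (a + 1)) := ⟨by positivity⟩
  haveI : Fact (1 < 2 ^ (a + 1)) := ⟨Nat.one_lt_two_pow (by omega)⟩
  haveI : Fintype (Multiplicative (ZMod p) ⋊[φ] Multiplicative (ZMod (2 ^ (a + j + 1)))) :=
    Fintype.ofEquiv _ SemidirectProduct.equivProd.symm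
  have hn : 0 < 2 ^ j := by positivity
  have hK : (2 : ℕ) ^ (a + j + 1) = 2 ^ j * 2 ^ (a + 1) := by rw [← pow_add]; congr 1; ring
  have hK' : (2 : ℕ) ^ (a + 1) = 2 * 2 ^ a := by rw [pow_succ]; ring
  have hK'' : (2 : ℕ) ^ (a + j) = 2 ^ j * 2 ^ a := by rw [← pow_add, add_comm]
  -- `2^j ∈ ℤ/2^{a+j+1}` has order `2^{a+1}`
  have hpowJ : ∀ k : ℕ, Multiplicative.ofAdd (((2 ^ j : ℕ) : ZMod (2 ^ (a + j + 1)))) ^ k =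
      Multiplicative.ofAdd (((2 ^ j * k : ℕ) : ZMod (2 ^ (a + j + 1)))) :=
    fun k => by rw [← ofAdd_nsmul, nsmul_eq_mul, Nat.cast_mul, mul_comm]
  have hJJ : Multiplicative.ofAdd (((2 ^ j : ℕ) : ZMod (2 ^ (a + j + 1)))) ^ 2 ^ (a + 1) = 1 := by
    rw [hpowJ, ← hK, ZMod.natCast_self]; rfl
  -- the abelian subgroup `⟨y^{2^j}⟩ × ⟨u⟩ ≅ ℤ/2^{a+1} × ℤ/p`
  let f : Multiplicative (ZMod (2 ^ (a + 1))) × Multiplicative (ZMod p) →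
      Multiplicative (ZMod p) ⋊[φ] Multiplicative (ZMod (2 ^ (a + j + 1))) :=
    fun w => ⟨w.2, Multiplicative.ofAdd (((2 ^ j : ℕ) : ZMod (2 ^ (a + j + 1)))) ^ (Multiplicative.toAdd w.1).val⟩
  have hf_apply : ∀ w, f w =
      ⟨w.2, Multiplicative.ofAdd (((2 ^ j : ℕ) : ZMod (2 ^ (a + j + 1)))) ^ (Multiplicative.toAdd w.1).val⟩ := fun w => rfl
  let i : Multiplicative (ZMod (2 ^ (a + 1))) × Multiplicative (ZMod p) →*
      Multiplicative (ZMod p) ⋊[φ] Multiplicative (ZMod (2 ^ (a + j + 1))) :=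
    MonoidHom.mk' f fun w w' => by
      refine SemidirectProduct.ext ?_ ?_
      · simp only [hf_apply, SemidirectProduct.mul_left, Prod.snd_mul, phi_two_pow_pow hp φ r hφ hr]
      · simp only [hf_apply, SemidirectProduct.mul_right, Prod.fst_mul, toAdd_mul, ← pow_add]
        rw [ZMod.val_add, ← pow_eq_pow_mod _ hJJ]
  have hi_apply : ∀ w, i w =
      ⟨w.2, Multiplicative.ofAdd (((2 ^ j : ℕ) : ZMod (2 ^ (a + j + 1)))) ^ (Multiplicative.toAdd w.1).val⟩ := fun w => rfl
  have hval : ∀ t : Multiplicative (ZMod (2 ^ (a + 1))), (Multiplicative.toAdd t).val < 2 ^ (a + 1) :=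
    fun t => ZMod.val_lt _
  have hJdvd : (2 ^ j : ℕ) ∣ 2 ^ (a + j + 1) := ⟨2 ^ (a + 1), hK⟩
  have hinjJ : ∀ k k' : ℕ, k < 2 ^ (a + 1) → k' < 2 ^ (a + 1) →
      Multiplicative.ofAdd (((2 ^ j : ℕ) : ZMod (2 ^ (a + j + 1)))) ^ k =
        Multiplicative.ofAdd (((2 ^ j : ℕ) : ZMod (2 ^ (a + j + 1)))) ^ k' → k = k' := by
    intro k k' hk hk' h
    rw [hpowJ, hpowJ, Equiv.apply_eq_iff_eq, ZMod.natCast_eq_natCast_iff', hK,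
      Nat.mod_eq_of_lt (Nat.mul_lt_mul_of_pos_left hk hn), Nat.mod_eq_of_lt (Nat.mul_lt_mul_of_pos_left hk' hn)] at h
    exact Nat.eq_of_mul_eq_mul_left hn h
  have hne : ∀ k l : ℕ, 0 < l → l < 2 ^ j →
      Multiplicative.ofAdd (((2 ^ j : ℕ) : ZMod (2 ^ (a + j + 1)))) ^ k ≠
        Multiplicative.ofAdd ((l : ℕ) : ZMod (2 ^ (a + j + 1))) := by
    intro k l hl hlJ h
    rw [hpowJ, Equiv.apply_eq_iff_eq] at h
    have h2 := congrArg (ZMod.castHom hJdvd (ZMod (2 ^ j))) h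
    rw [map_natCast, map_natCast, ZMod.natCast_eq_natCast_iff', Nat.mul_mod_right, Nat.mod_eq_of_lt hlJ] at h2
    omega
  have hi : Function.Injective i := by
    rintro ⟨t, v⟩ ⟨t', v'⟩ h
    rw [hi_apply, hi_apply, SemidirectProduct.ext_iff] at h
    refine Prod.ext ?_ h.1
    have := hinjJ _ _ (hval t) (hval t') h.2
    exact Multiplicative.toAdd.injective (ZMod.val_injective _ this)
  -- the sheets `i(A) · y^l`, `y = inr 1`
  set y : Multiplicative (ZMod p) ⋊[φ] Multiplicative (ZMod (2 ^ (a + j + 1))) :=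
    SemidirectProduct.inr (Multiplicative.ofAdd (1 : ZMod (2 ^ (a + j + 1)))) with hy_def
  have hy : y = ⟨1, Multiplicative.ofAdd 1⟩ := rfl
  have hyl : ∀ l : ℕ, y ^ l = ⟨1, Multiplicative.ofAdd ((l : ℕ) : ZMod (2 ^ (a + j + 1)))⟩ := fun l => by
    rw [hy_def, ← map_pow, ← ofAdd_nsmul, nsmul_eq_mul, mul_one]; rfl
  have hx : ∀ l, 0 < l → l < 2 ^ j → ∀ w, i w ≠ y ^ l := fun l hl hlJ ⟨t, v⟩ h => by
    rw [hi_apply, hyl, SemidirectProduct.ext_iff] at h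
    exact hne _ l hl hlJ h.2
  have hcov : ∀ g : Multiplicative (ZMod p) ⋊[φ] Multiplicative (ZMod (2 ^ (a + j + 1))),
      ∃ l, l < 2 ^ j ∧ ∃ w, g = i w * y ^ l := by
    rintro ⟨v, m⟩
    set nn : ℕ := (Multiplicative.toAdd m).val with hnn_def
    have hnn : nn < 2 ^ (a + j + 1) := ZMod.val_lt _
    have hdiv : nn / 2 ^ j < 2 ^ (a + 1) := by
      rw [Nat.div_lt_iff_lt_mul hn, mul_comm, ← hK]; exact hnn
    have hkJ : ((nn / 2 ^ j : ℕ) : ZMod (2 ^ (a + 1))).val = nn / 2 ^ j := ZMod.val_natCast_of_lt hdiv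
    have hm : m = Multiplicative.ofAdd (((2 ^ j : ℕ) : ZMod (2 ^ (a + j + 1)))) ^ (nn / 2 ^ j) *
        Multiplicative.ofAdd (((nn % 2 ^ j : ℕ) : ZMod (2 ^ (a + j + 1)))) := by
      rw [hpowJ, ← ofAdd_add, ← Nat.cast_add, Nat.div_add_mod nn (2 ^ j), hnn_def, ZMod.natCast_zmod_val, ofAdd_toAdd]
    refine ⟨nn % 2 ^ j, Nat.mod_lt _ hn, (Multiplicative.ofAdd ((nn / 2 ^ j : ℕ) : ZMod (2 ^ (a + 1))), v), ?_⟩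
    rw [hi_apply, toAdd_ofAdd, hkJ, hyl, SemidirectProduct.mul_def]
    refine SemidirectProduct.ext ?_ ?_
    · simp
    · simpa using hm
  -- conjugation by `y` is `θ(t, v) = (t, v^r)`; `y^{2^j} = i(1, 0)`
  let θ : MulAut (Multiplicative (ZMod (2 ^ (a + 1))) × Multiplicative (ZMod p)) :=
    MulEquiv.prodCongr (MulEquiv.refl _) (φ (Multiplicative.ofAdd 1))
  have hθ_apply : ∀ w, θ w = (w.1, w.2 ^ r) := fun w => by
    change (w.1, φ (Multiplicative.ofAdd 1) w.2) = _; rw [hφ]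
  have hθ : ∀ w, y * i w = i (θ w) * y := fun ⟨t, v⟩ => by
    rw [hi_apply, hi_apply, hθ_apply, hy, SemidirectProduct.mul_def, SemidirectProduct.mul_def]
    refine SemidirectProduct.ext ?_ ?_
    · simp [hφ]
    · simp [mul_comm]
  set q : Multiplicative (ZMod (2 ^ (a + 1))) × Multiplicative (ZMod p) := (Multiplicative.ofAdd 1, 1) with hq_def
  have h1val : (1 : ZMod (2 ^ (a + 1))).val = 1 := ZMod.val_one _
  have h2a : 2 ^ a < 2 ^ (a + 1) := Nat.pow_lt_pow_right (by norm_num) (by omega)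
  have h2val : (((2 ^ a : ℕ) : ZMod (2 ^ (a + 1)))).val = 2 ^ a := ZMod.val_natCast_of_lt h2a
  have hyq : y ^ 2 ^ j = i q := by
    rw [hi_apply, hq_def, toAdd_ofAdd, h1val, pow_one, hyl]
  set c : Multiplicative (ZMod (2 ^ (a + 1))) × Multiplicative (ZMod p) :=
    (Multiplicative.ofAdd (((2 ^ a : ℕ) : ZMod (2 ^ (a + 1)))), 1) with hc_def
  have hic : i c = SemidirectProduct.inr (Multiplicative.ofAdd ((2 ^ (a + j) : ℕ) : ZMod (2 ^ (a + j + 1)))) := by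
    rw [hi_apply, hc_def, toAdd_ofAdd, h2val, hpowJ, ← hK'']
    rfl
  have h22 : (((2 ^ a : ℕ) : ZMod (2 ^ (a + 1)))) + ((2 ^ a : ℕ) : ZMod (2 ^ (a + 1))) = 0 := by
    rw [← Nat.cast_add, ← two_mul, ← hK', ZMod.natCast_self]
  have hcc : c * c = 1 := by
    rw [hc_def, Prod.mk_mul_mk, mul_one, ← ofAdd_add, h22]; rfl
  -- the sheets of `S`
  set Sh : ℕ → Finset (Multiplicative (ZMod (2 ^ (a + 1))) × Multiplicative (ZMod p)) :=
    fun l => Finset.univ.filter fun w => i w * y ^ l ∈ S with hSh_def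
  have hSh : ∀ l, l < 2 ^ j → ∀ w, w ∈ Sh l ↔ i w * y ^ l ∈ S := fun l _ w => by simp [hSh_def]
  have hSh' : ∀ l w, w ∈ Sh l ↔ i w * y ^ l ∈ S := fun l w => by simp [hSh_def]
  have hShcm : ∀ l, IsCMTypeWith c (↑(Sh l) : Set (Multiplicative (ZMod (2 ^ (a + 1))) × Multiplicative (ZMod p))) := by
    intro l
    refine ⟨fun w => ?_, fun g w => ?_, fun w => ?_⟩
    · rw [Finset.mem_coe, Finset.mem_coe, hSh', hSh', smul_eq_mul, map_mul, hic, mul_assoc, hScm, not_not]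
    · simp only [smul_eq_mul, mul_left_comm]
    · rw [smul_eq_mul, smul_eq_mul, ← mul_assoc, hcc, one_mul]
  -- the stabilising element `γ^{2^{a+1}} = (0, 2^{a+1}) ↦ u^{2^{a+1}} = inl 2^{a+1}`
  have h4 : ((Multiplicative.ofAdd (1 : ZMod (2 ^ (a + 1))), Multiplicative.ofAdd (1 : ZMod p)) :
      Multiplicative (ZMod (2 ^ (a + 1))) × Multiplicative (ZMod p)) ^ 2 ^ (a + 1) =
      (1, Multiplicative.ofAdd (((2 ^ (a + 1) : ℕ) : ZMod p))) := by
    rw [Prod.pow_mk, ← ofAdd_nsmul, ← ofAdd_nsmul, nsmul_eq_mul, nsmul_eq_mul, mul_one, mul_one, ZMod.natCast_self]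
    rfl
  have hγ4 : i (((Multiplicative.ofAdd (1 : ZMod (2 ^ (a + 1))), Multiplicative.ofAdd (1 : ZMod p)) :
      Multiplicative (ZMod (2 ^ (a + 1))) × Multiplicative (ZMod p)) ^ 2 ^ (a + 1)) =
      SemidirectProduct.inl (Multiplicative.ofAdd (((2 ^ (a + 1) : ℕ) : ZMod p))) := by
    rw [h4, hi_apply, toAdd_one, ZMod.val_zero, pow_zero]
    rfl
  -- orders in `A`
  have hcardA : Fintype.card (Multiplicative (ZMod (2 ^ (a + 1))) × Multiplicative (ZMod p)) = 2 ^ (a + 1) * p := by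
    rw [Fintype.card_prod, Fintype.card_multiplicative, Fintype.card_multiplicative, ZMod.card, ZMod.card]
  have hχ1 : ∀ (χ : AddChar (Additive (Multiplicative (ZMod (2 ^ (a + 1))) × Multiplicative (ZMod p))) ℂ)
      (t : Multiplicative (ZMod (2 ^ (a + 1))) × Multiplicative (ZMod p)) (n : ℕ), t ^ n = 1 →
      χ (Additive.ofMul t) ^ n = 1 := fun χ t n h => by
    rw [← map_nsmul_eq_pow, ← ofMul_pow, h, ofMul_one, map_zero_eq_one]
  have ht2 : ∀ t : Multiplicative (ZMod (2 ^ (a + 1))), t ^ 2 ^ (a + 1) = 1 := fun t => by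
    have := pow_card_eq_one (G := Multiplicative (ZMod (2 ^ (a + 1)))) (x := t)
    rwa [Fintype.card_multiplicative, ZMod.card] at this
  have hvp : ∀ v : Multiplicative (ZMod p), v ^ p = 1 := fun v => by
    have := pow_card_eq_one (G := Multiplicative (ZMod p)) (x := v)
    rwa [Fintype.card_multiplicative, ZMod.card] at this
  -- injectivity of the transformed systems on odd characters
  refine NSheet.eq_zero_of_cyclicSheet i hi y hx hcov θ hθ q hyq hcc S Sh hSh ?_ b
    (fun g => by rw [hic]; exact hb g) hann
  intro χ hχ δ hδ u husys
  -- the values of `χ` inside `M`, and `σ(χ(θ t)) = χ(t)`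
  have hχM : ∀ t, χ (Additive.ofMul t) ∈ M := fun t =>
    hM _ (hχ1 χ t _ (by rw [← hcardA]; exact pow_card_eq_one))
  set χM : Multiplicative (ZMod (2 ^ (a + 1))) × Multiplicative (ZMod p) → M :=
    fun t => ⟨χ (Additive.ofMul t), hχM t⟩ with hχM_def
  have hχM_coe : ∀ t, ((χM t : M) : ℂ) = χ (Additive.ofMul t) := fun t => rfl
  have hχM_mul : ∀ s t, χM (s * t) = χM s * χM t := fun s t =>
    Subtype.ext (by simp only [hχM_coe, Subfield.coe_mul, ofMul_mul, map_add_eq_mul])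
  have hχM_pow : ∀ t (n : ℕ), χM (t ^ n) = χM t ^ n := fun t n =>
    Subtype.ext (by simp only [hχM_coe, SubmonoidClass.coe_pow, ofMul_pow, map_nsmul_eq_pow])
  have hσθ : ∀ t, σ (χM (θ t)) = χM t := by
    rintro ⟨t, v⟩
    have hsplit : ((t, v) : Multiplicative (ZMod (2 ^ (a + 1))) × Multiplicative (ZMod p)) = (t, 1) * (1, v) := by
      rw [Prod.mk_mul_mk, mul_one, one_mul]
    have hsplit' : ((t, v ^ r) : Multiplicative (ZMod (2 ^ (a + 1))) × Multiplicative (ZMod p)) =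
        (t, 1) * (1, v) ^ r := by
      rw [Prod.pow_mk, one_pow, Prod.mk_mul_mk, mul_one, one_mul]
    rw [hθ_apply]
    simp only
    rw [hsplit', hχM_mul, hχM_pow, map_mul,
      hσ2 _ (by rw [hχM_coe]; exact hχ1 χ _ _ (by rw [Prod.pow_mk, one_pow, ht2]; rfl)),
      hσp _ (by rw [hχM_coe]; exact hχ1 χ _ _ (by rw [Prod.pow_mk, one_pow, hvp]; rfl)), ← hχM_mul, ← hsplit]
  have hσχ : ∀ t, σ (χM t) = χM (θ⁻¹ t) := fun t => by
    have h := hσθ (θ⁻¹ t)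
    rwa [MulAut.apply_inv_self] at h
  have hσχk : ∀ (k : ℕ) t, σ^[k] (χM t) = χM ((θ⁻¹ ^ k) t) := by
    intro k
    induction k with
    | zero => intro t; rw [Function.iterate_zero, id, pow_zero, MulAut.one_apply]
    | succ k ih => intro t; rw [Function.iterate_succ_apply', ih, hσχ, pow_succ' θ⁻¹ k, MulAut.mul_apply]
  -- the sheet sums inside `M`
  set s : ℕ → M := fun l => ∑ t ∈ Sh l, χM t with hs_def
  have hσs : ∀ (k l : ℕ), (((σ^[k] (s l) : M)) : ℂ) = ∑ t ∈ Sh l, χ (Additive.ofMul ((θ⁻¹ ^ k) t)) := by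
    intro k l
    rw [← RingHom.coe_pow, hs_def, map_sum, ← Subfield.coe_subtype, map_sum]
    refine Finset.sum_congr rfl fun t _ => ?_
    rw [RingHom.coe_pow, hσχk, Subfield.coe_subtype, hχM_coe]
  have hs_coe : ∀ l, ((s l : M) : ℂ) = ∑ t ∈ Sh l, χ (Additive.ofMul t) := fun l => by
    have := hσs 0 l
    simpa using this
  -- `ω₀ = χ(q)`, a primitive `2^{a+1}`-th root of unity fixed by `σ`
  set ω₀ : M := χM q with hω₀_def
  have hω₀a : ((ω₀ : M) : ℂ) ^ 2 ^ a = -1 := by rw [hω₀_def, hχM_coe, hq_def]; exact pow_omega χ hχ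
  have hω₀ne : ω₀ ≠ 0 := by
    intro h
    have h' : ((ω₀ : M) : ℂ) = 0 := by rw [h]; rfl
    rw [h', zero_pow (by positivity)] at hω₀a
    norm_num at hω₀a
  have hσω : σ ω₀ = ω₀ := hσ2 _ (by rw [hK', mul_comm, pow_mul, hω₀a]; norm_num)
  have hσns : ∀ l, σ^[2 ^ j] (s l) = s l := fun l => hσn _
  -- the `2^j`-sheet matrix and its monomial intertwiners
  set Mat : Matrix (Fin (2 ^ j)) (Fin (2 ^ j)) M := fun i₀ k =>
    (if (i₀ : ℕ) + (((k : ℕ) + δ + 2 ^ j - i₀) % 2 ^ j) < 2 ^ j then 1 else ω₀) *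
      σ^[k] (s (((k : ℕ) + δ + 2 ^ j - i₀) % 2 ^ j)) with hMat_def
  have hMat : ∀ i₀ k : Fin (2 ^ j), Mat i₀ k =
      (if (i₀ : ℕ) + (((k : ℕ) + δ + 2 ^ j - i₀) % 2 ^ j) < 2 ^ j then 1 else ω₀) *
        σ^[k] (s (((k : ℕ) + δ + 2 ^ j - i₀) % 2 ^ j)) := fun _ _ => rfl
  set P : Matrix (Fin (2 ^ j)) (Fin (2 ^ j)) M := fun i₀ k =>
    if (i₀ : ℕ) = ((k : ℕ) + 1) % 2 ^ j then (if (k : ℕ) = 2 ^ j - 1 - δ then ω₀⁻¹ else 1) else 0 with hP_def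
  have hP : ∀ i₀ k : Fin (2 ^ j), P i₀ k =
      if (i₀ : ℕ) = ((k : ℕ) + 1) % 2 ^ j then (if (k : ℕ) = 2 ^ j - 1 - δ then ω₀⁻¹ else 1) else 0 := fun _ _ => rfl
  set P' : Matrix (Fin (2 ^ j)) (Fin (2 ^ j)) M := fun i₀ k =>
    if (i₀ : ℕ) = ((k : ℕ) + 1) % 2 ^ j then (if (k : ℕ) = 2 ^ j - 1 then ω₀⁻¹ else 1) else 0 with hP'_def
  have hP' : ∀ i₀ k : Fin (2 ^ j), P' i₀ k =
      if (i₀ : ℕ) = ((k : ℕ) + 1) % 2 ^ j then (if (k : ℕ) = 2 ^ j - 1 then ω₀⁻¹ else 1) else 0 := fun _ _ => rfl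
  have hMP := sheet_mul_eq_mul_map hn σ ω₀ hω₀ne hσω s hσns δ hδ Mat P P' hMat hP hP'
  have hPn := sheetP_pow_eq hn ω₀ δ hδ P hP
  have hQs : ∀ k : ℕ, P ^ (k + 1) = P * (P ^ k).map σ := fun k => by
    rw [sheetP_pow_map_eq σ ω₀ hσω δ P hP, pow_succ']
  by_cases hdet : Mat.det = 0
  · exfalso
    by_cases hM0 : Mat = 0
    · -- all `2^j` sheet sums vanish: every sheet is `C_p`-periodic, contradicting `hstab`
      have hs0 := sheetSum_eq_zero_of_sheet_eq_zero hn σ ω₀ hω₀ne s δ hδ Mat hMat hM0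
      have hS0 : ∀ l, l < 2 ^ j → ∑ t ∈ Sh l, χ (Additive.ofMul t) = 0 := fun l hl => by
        rw [← hs_coe, hs0 l hl]; rfl
      have hper : ∀ l, l < 2 ^ j → ∀ g, g ∈ Sh l ↔
          g * ((Multiplicative.ofAdd (1 : ZMod (2 ^ (a + 1))), Multiplicative.ofAdd (1 : ZMod p)) :
            Multiplicative (ZMod (2 ^ (a + 1))) × Multiplicative (ZMod p)) ^ 2 ^ (a + 1) ∈ Sh l := fun l hl =>
        mul_pow_mem_iff_of_sum_eq_zero (a := a) (q := p) hp hp2 (orderOf_gamma hp2) (mem_powers_gamma hp2) (hShcm l)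
          χ hχ (hS0 l hl)
      apply hstab
      intro w
      obtain ⟨l, hl, u', rfl⟩ := hcov w
      rw [← hγ4, ← mul_assoc, ← map_mul, mul_comm _ u', ← hSh l hl, ← hSh l hl]
      exact hper l hl u'
    · -- the semilinear kernel trick: `ω₀^{-d}` is a degree-`2^j` norm
      obtain ⟨d, hd1, hd4, z, hz⟩ :=
        SemilinearKernel.exists_norm_eq_pow_of_det_eq_zero_cyclic σ (2 ^ j) hσn Mat P P' ω₀⁻¹ hMP (fun k => P ^ k)
          (pow_zero P) hQs hPn hdet hM0
      rw [Fintype.card_fin] at hd4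
      obtain ⟨sx, d', hd', rfl⟩ := Nat.exists_eq_two_pow_mul_odd (Nat.pos_iff_ne_zero.1 hd1)
      obtain ⟨t, rfl⟩ := hd'
      -- `s < j`
      have hsj : sx < j := by
        by_contra hge
        have h1 : 2 ^ j ≤ 2 ^ sx := Nat.pow_le_pow_right (by norm_num) (by omega)
        have h2 : 2 ^ sx ≤ 2 ^ sx * (2 * t + 1) := Nat.le_mul_of_pos_right _ (by omega)
        omega
      have hω₀inv : (((ω₀⁻¹ : M)) : ℂ) = ((ω₀ : M) : ℂ)⁻¹ := Subfield.coe_inv _ _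
      have hωa : (((ω₀ : M) : ℂ)⁻¹) ^ 2 ^ a = -1 := by rw [inv_pow, hω₀a]; norm_num
      refine hN (z ^ 2 ^ (j - 1 - sx)) _ hωa t ?_
      rw [prod_iterate_pow, hz, SubmonoidClass.coe_pow, SubmonoidClass.coe_pow, hω₀inv, ← pow_mul]
      congr 1
      rw [show 2 ^ sx * (2 * t + 1) * 2 ^ (j - 1 - sx) = (2 ^ sx * 2 ^ (j - 1 - sx)) * (2 * t + 1) by ring, ← pow_add,
        show sx + (j - 1 - sx) = j - 1 by omega]
  · -- `det ≠ 0`: the system has only the trivial solution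
    have hdetC : (Mat.map M.subtype).det ≠ 0 := by
      rw [← RingHom.mapMatrix_apply, ← RingHom.map_det]
      exact fun h => hdet (M.subtype.injective (by rw [h, map_zero]))
    refine apply_eq_zero_of_sheet_det_ne_zero hn (fun i₀ l => if i₀ + l < 2 ^ j then (1 : ℂ) else χ (Additive.ofMul q))
      (fun l k => ∑ t ∈ Sh l, χ (Additive.ofMul ((θ⁻¹ ^ k) t))) δ hδ u husys (Mat.map M.subtype) (fun i₀ k => ?_)
      hdetC 0 hn
    rw [Matrix.map_apply, hMat, map_mul, Subfield.coe_subtype, hσs]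
    congr 1
    split_ifs
    · rfl
    · rfl

end Model

end Summit.HodgeConjecture.CorCM.GaloisMetacyclicTwoPower

end
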